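import Mathlib
import HarnessLib
import Summits.QuantumFields.YangMills.Theses.ScalingWindowSplit
import Summits.QuantumFields.YangMills.Theorems.ScalingWindowSplitExistenceLegFromLattice
import Summits.QuantumFields.YangMills.Theorems.ScalingWindowSplitExistenceLegFromLatticeR

/-!
# Route `ScalingWindowSplit`, support item `ExistenceLegFromLatticeGapped` (stmt-QuantumFields-18171)

THE TYPED SPLIT of the route, re-pointed at the REPAIRED non-triviality item W₂ᴳ (rev 8): the three lattice items
`GapAtCorrelationLength` (W₁, IR, renormalisation-free, `∃` over `(r, sch, u, p, M, Δ, C)` with a PAST-SUPPORTED bump `u`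
and the volume-uniform lattice mass gap `HasLatticeMassGap r sch Δ`),
`SelfNormalisedSkewnessGapped` (W₂ᴳ, `κ₃` floor of the self-normalised field, now ASSUMING W₁'s gap: binders
`0 < Δ → HasLatticeMassGap r sch Δ →` right after `sch.HasWeakCouplingLimit →`) and
`SelfNormalisedMomentBoundsR` (U_R, `k`-uniform plane-resolved `n!`-moment bounds of the self-normalised field)
imply the shared existence leg `CoincidenceRotationBootstrap.HypercubicLimit` (stmt-QuantumFields-16154) BY NAME.

Proof: literally the landed `existenceLegFromLatticeR_proof`
(`Theorems/ScalingWindowSplitExistenceLegFromLatticeR.lean`) with W₁'s gap `Δ, hΔ, hgap` also fed to W₂ᴳ.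
Fix a compact simple `G`; W₁ gives `(r, sch, u, p, M, Δ, C)`; U_R and W₂ᴳ at that witness give the self-normalised
moment bounds and the `κ₃` floor; the landed seam `oneField_of_latticeInequalities` gives a weak-coupling scheme with
the one-field clauses, and ONE FIELD SUFFICES (`hypercubicLimit_iff_oneFieldWeak`).

Corollary: the unrepaired W₂ `SelfNormalisedSkewness` trivially implies W₂ᴳ (two more hypotheses, ignored), so the
gapped split implies the rev-6 split `ExistenceLegFromLatticeR` (`existenceLegFromLatticeR_of_gapped`).

References: Glimm–Jaffe, *Quantum Physics* (1987) §6.1, §19.1 (truncated functions, renormalisation);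
Osterwalder–Seiler, Ann. Phys. 110 (1978) §2.  No definitions, no notation, no named facts.
-/

noncomputable section

open scoped SchwartzMap BigOperators Topology Classical MeasureTheory ProbabilityTheory Matrix
open MeasureTheory ProbabilityTheory Filter Topology
open Literature.MathematicalPhysics.AQFT Literature.MathematicalPhysics.QuantumLattice
open Literature.MathematicalPhysics.QuantumFieldTheory

namespace Summit.QuantumFields.YangMills.Theorems.ScalingWindowSplit

/-- **Support item `ExistenceLegFromLatticeGapped`** of route `ScalingWindowSplit` (stmt-QuantumFields-18171), THE
TYPED SPLIT re-pointed at the repaired W₂ᴳ: `GapAtCorrelationLength → SelfNormalisedSkewnessGapped →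
SelfNormalisedMomentBoundsR → CoincidenceRotationBootstrap.HypercubicLimit`.  Fix a compact simple `G`; W₁ gives
`(r, sch, u, p, M, Δ, C)` with `u` past-supported and the uniform lattice gap at `Δ`; U_R and W₂ᴳ at that witness
(W₂ᴳ now also reads W₁'s `0 < Δ` and `HasLatticeMassGap r sch Δ`) give the self-normalised moment bounds and the
`κ₃` floor; the seam (`oneField_of_latticeInequalities`) gives a weak-coupling scheme with the one-field clauses, and
ONE FIELD SUFFICES (`hypercubicLimit_iff_oneFieldWeak`). [cite: GlimmJaffe1987, §6.1 and §19.1] -/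
theorem existenceLegFromLatticeGapped_proof :
    Summit.QuantumFields.YangMills.Theses.ScalingWindowSplit.ExistenceLegFromLatticeGapped := by
  unfold Summit.QuantumFields.YangMills.Theses.ScalingWindowSplit.ExistenceLegFromLatticeGapped
  intro hW hS hU
  refine Summit.QuantumFields.YangMills.Theorems.HypercubicLimit.OneFieldWeak.hypercubicLimit_iff_oneFieldWeak.mpr
    fun G _ _ _ _ hG => ?_
  letI : MeasurableSpace G := borel G
  haveI : BorelSpace G := ⟨rfl⟩
  obtain ⟨r, sch, u, p, M, Δ, C, hw, hpv, hΔ, hgap, hrp, hu, hfw⟩ := hW G hG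
  obtain ⟨sch', S₁, hw', h₁⟩ := oneField_of_latticeInequalities r sch u p M Δ C hw hpv hΔ hgap hrp hu hfw
    (hU G r sch u p M hw hpv hu hfw) (hS G r sch u p M Δ hw hΔ hgap hpv hu hfw)
  exact ⟨r, sch', S₁, hw', h₁⟩

/-- The gapped split implies the rev-6 split through the unrepaired W₂: `SelfNormalisedSkewness` (no gap
hypotheses) trivially implies `SelfNormalisedSkewnessGapped` (two more hypotheses `0 < Δ`, `HasLatticeMassGap r sch Δ`,
ignored), so `ExistenceLegFromLatticeGapped → ExistenceLegFromLatticeR`. [folklore] -/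
theorem existenceLegFromLatticeR_of_gapped
    (hLeg : Summit.QuantumFields.YangMills.Theses.ScalingWindowSplit.ExistenceLegFromLatticeGapped) :
    Summit.QuantumFields.YangMills.Theses.ScalingWindowSplit.ExistenceLegFromLatticeR := by
  unfold Summit.QuantumFields.YangMills.Theses.ScalingWindowSplit.ExistenceLegFromLatticeR
  intro hW hS hU
  refine hLeg hW ?_ hU
  intro G _ _ _ _ _ _ r sch u p M Δ bare T canon hw _hΔ _hgap hpv hu hfw
  exact hS G r sch u p M hw hpv hu hfw

/-- Hence the gapped split also implies the rev-0 split `ExistenceLegFromLattice` (via the landed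
`existenceLegFromLattice_of_R`). [folklore] -/
theorem existenceLegFromLattice_of_gapped
    (hLeg : Summit.QuantumFields.YangMills.Theses.ScalingWindowSplit.ExistenceLegFromLatticeGapped) :
    Summit.QuantumFields.YangMills.Theses.ScalingWindowSplit.ExistenceLegFromLattice :=
  existenceLegFromLattice_of_R (existenceLegFromLatticeR_of_gapped hLeg)

end Summit.QuantumFields.YangMills.Theorems.ScalingWindowSplit

end
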